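import Summits.HubbardSuperconductivity.HubbardSuperconductivity.Theorems.NodalWardXYVisonPairCostRankWindow
import Literature.MathematicalPhysics.QuantumLattice.BdGNambuLogDetMoments

/-!
# Crux `NodalWardXY.VisonPairCost` (stmt-HubbardSuperconductivity-1266), line `Sketch`:
# the ultraviolet stub `stub_ultraviolet : Ultraviolet` — moment locality of `tr N_R^m`

`N_R = visonNambu L μ Δ₀ R` is the Nambu matrix whose bond data carry the sign `−1` on the `R`
string bonds `(a,0)–(a,1)`, `a < R` (vocabulary `…VisonPairCostDefs.lean`; `isHermitian_visonNambu`,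
`visonHop_swap`, `sgn_zero_right` from `…VisonPairCostRankWindow.lean`; the matrix toolkit —
log-determinant series, light cone, torus balls, gauge covariance — is
`Literature/MathematicalPhysics/QuantumLattice/BdGNambuLogDetMoments.lean`).  With
`K = 8 + 8|Δ₀| + |μ|` (row-sum bound, `visonNambu_row_le`):
* **local Z₂ gauge** (`exists_local_gauge`): around a site `x` whose sup-circular ball `B(x,m)`
  stays away from both string ends (`4m + 2 ≤ L`) some `ε = ±1` reproduces `s_R` on every bond
  leaving the ball (`ε ≡ 1`, or `ε = −1` exactly on the rows `1 … ⌊L/2⌋`); with the gauge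
  covariance of the bond data (`visonHop_gauge`, `visonPair_gauge`), the range-one light cone and
  `E² = 1`, `(N_R^m)_{oo} = (N_0^m)_{oo}` over every far site (`pow_apply_self_eq_of_far`);
* **moment locality** (`abs_trace_pow_sub_le`): `|tr N_R^m − tr N_0^m| ≤ 16(2m+1)² K^m` uniformly
  in `L`, `2R ≤ L` (`≤ 2(2m+1)²` near sites, each `≤ 4K^m`; if `L ≤ 4m+1` all `L²` sites count);
* **the stub** (`stub_ultraviolet`): `|D_t| ≤ 400K²/t²` for `t ≥ 2K` (log-determinant series).
References: the crux docstring (`Theses/NodalWardXY.lean`); T. Senthil, M. P. A. Fisher, PRB 62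
(2000) 7850, §III (visons as Z₂ fluxes; local gauge classes).  No definition is introduced.
-/

noncomputable section

-- tree namespace Summit.HubbardSuperconductivity.HubbardSuperconductivity (D-0017)
set_option linter.dupNamespace false

namespace Summit.HubbardSuperconductivity.HubbardSuperconductivity.Theorems.VisonPairCost

open Literature.Probability.LatticeModels Literature.MathematicalPhysics.QuantumLattice
open scoped Matrix

section Vison

variable {L : ℕ} [NeZero L]

omit [NeZero L] in
/-- `|s_R| = 1`. -/
theorem abs_sgn (R : ℕ) (x : TorusSite 2 L) (i : Fin 2) : |sgn L R x i| = 1 := by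
  unfold sgn; split_ifs <;> simp

/-- **Row sums** of the Nambu matrix: `Σ_{o'} |N_R(o,o')| ≤ 8 + 8|Δ₀| + |μ|` (at most four
neighbours in each bond direction, hopping `|τ| = 1`, pairing `|Δ| = |Δ₀|`). -/
theorem visonNambu_row_le (μ Δ₀ : ℝ) (R : ℕ) (o : Orb (FermionTorus 2 L)) :
    ∑ o', ‖visonNambu L μ Δ₀ R o o'‖ ≤ 8 + 8 * |Δ₀| + |μ| := by
  obtain ⟨⟨u, σ⟩, rfl⟩ : ∃ p : FermionTorus 2 L × Fin 2, toLex p = o := ⟨ofLex o, rfl⟩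
  -- adjacency indicators of the two bond orientations
  set A : Fin 2 → FermionTorus 2 L → ℝ := fun i v =>
    (if v.toTorusSite = u.toTorusSite + Pi.single i 1 then 1 else 0) +
      (if u.toTorusSite = v.toTorusSite + Pi.single i 1 then 1 else 0) with hA
  have hAsum : ∀ i, ∑ v, A i v = 2 := by
    intro i
    simp only [hA, Finset.sum_add_distrib]
    rw [← Equiv.sum_comp FermionTorus.equivTorusSite.symm,
      ← Equiv.sum_comp FermionTorus.equivTorusSite.symm]
    simp only [FermionTorus.equivTorusSite, Equiv.coe_fn_symm_mk,
      FermionTorus.toTorusSite_ofTorusSite]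
    have hiff : ∀ z : TorusSite 2 L, (u.toTorusSite = z + Pi.single i 1) ↔
        (z = u.toTorusSite - Pi.single i 1) := fun z => by rw [eq_sub_iff_add_eq, eq_comm]
    simp only [hiff, Finset.sum_ite_eq', Finset.mem_univ, if_true]
    norm_num
  have hτ : ∀ v, ‖visonHop L R u v‖ ≤ ∑ i, A i v := by
    intro v
    unfold visonHop
    rw [Complex.norm_real, Real.norm_eq_abs]
    refine (Finset.abs_sum_le_sum_abs _ _).trans (Finset.sum_le_sum fun i _ => ?_)
    refine (abs_add_le _ _).trans (add_le_add ?_ ?_) <;> split_ifs <;> simp [abs_sgn]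
  have hΔ : ∀ v, ‖visonPair L Δ₀ R u v‖ ≤ |Δ₀| * ∑ i, A i v ∧
      ‖visonPair L Δ₀ R v u‖ ≤ |Δ₀| * ∑ i, A i v := fun v => by
    constructor
    all_goals
      unfold visonPair
      rw [Complex.norm_real, Real.norm_eq_abs, Finset.mul_sum]
      refine (Finset.abs_sum_le_sum_abs _ _).trans (Finset.sum_le_sum fun i _ => ?_)
      simp only [hA]
      split_ifs <;> simp [abs_mul, abs_sgn] <;> nlinarith [abs_nonneg Δ₀]
  unfold visonNambu
  refine (sum_norm_bdgNambuMatrix_orb_le _ _ μ u σ).trans ?_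
  have hle : ∑ v, (‖visonHop L R u v‖ + ‖visonHop L R v u‖ + ‖visonPair L Δ₀ R u v‖ +
      ‖visonPair L Δ₀ R v u‖) ≤ ∑ v, (2 + 2 * |Δ₀|) * ∑ i, A i v :=
    Finset.sum_le_sum fun v _ => by
      have e1 := hτ v; have e3 := (hΔ v).1; have e4 := (hΔ v).2
      have e2 : ‖visonHop L R v u‖ ≤ ∑ i, A i v := by rw [visonHop_swap]; exact hτ v
      linarith
  rw [← Finset.mul_sum, Finset.sum_comm] at hle
  simp only [hAsum, Fin.sum_univ_two] at hle
  linarith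

/-- Entries of the Nambu matrix between distinct non-neighbouring sites vanish. -/
theorem visonNambu_apply_eq_zero (μ Δ₀ : ℝ) (R : ℕ) {u v : FermionTorus 2 L} (huv : u ≠ v)
    (h1 : ∀ i : Fin 2, v.toTorusSite ≠ u.toTorusSite + Pi.single i 1)
    (h2 : ∀ i : Fin 2, u.toTorusSite ≠ v.toTorusSite + Pi.single i 1) (σ σ' : Fin 2) :
    visonNambu L μ Δ₀ R (orb u σ) (orb v σ') = 0 := by
  have hτ : visonHop L R u v = 0 := by unfold visonHop; simp [h1, h2]
  have hτ' : visonHop L R v u = 0 := by rw [visonHop_swap]; exact hτ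
  have hΔ : visonPair L Δ₀ R u v = 0 := by unfold visonPair; simp [h1]
  have hΔ' : visonPair L Δ₀ R v u = 0 := by unfold visonPair; simp [h2]
  unfold visonNambu
  rw [bdgNambuMatrix_orb_orb, hτ, hτ', hΔ, hΔ', if_neg huv]
  split_ifs <;> simp

/-- Gauge relation for the hopping data: `τ_R(u,v) = ε_u ε_v τ_0(u,v)` when `ε` reproduces `s_R`
on the bonds at `u ∼ v`. -/
theorem visonHop_gauge (R : ℕ) {ε : FermionTorus 2 L → ℝ} {u v : FermionTorus 2 L}
    (huv : ∀ i : Fin 2, v.toTorusSite = u.toTorusSite + Pi.single i 1 →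
      ε u * ε v = sgn L R u.toTorusSite i)
    (hvu : ∀ i : Fin 2, u.toTorusSite = v.toTorusSite + Pi.single i 1 →
      ε u * ε v = sgn L R v.toTorusSite i) :
    visonHop L R u v = (ε u : ℂ) * ε v * visonHop L 0 u v := by
  unfold visonHop
  rw [← Complex.ofReal_mul, ← Complex.ofReal_mul, Finset.mul_sum]
  congr 1
  refine Finset.sum_congr rfl fun i _ => ?_
  rw [mul_add]
  congr 1
  · by_cases h : v.toTorusSite = u.toTorusSite + Pi.single i 1
    · rw [if_pos h, if_pos h, huv i h, sgn_zero_right]; ring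
    · rw [if_neg h, if_neg h, mul_zero]
  · by_cases h : u.toTorusSite = v.toTorusSite + Pi.single i 1
    · rw [if_pos h, if_pos h, hvu i h, sgn_zero_right]; ring
    · rw [if_neg h, if_neg h, mul_zero]

/-- Gauge relation for the pairing data. -/
theorem visonPair_gauge (Δ₀ : ℝ) (R : ℕ) {ε : FermionTorus 2 L → ℝ} {u v : FermionTorus 2 L}
    (huv : ∀ i : Fin 2, v.toTorusSite = u.toTorusSite + Pi.single i 1 →
      ε u * ε v = sgn L R u.toTorusSite i) :
    visonPair L Δ₀ R u v = (ε u : ℂ) * ε v * visonPair L Δ₀ 0 u v := by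
  unfold visonPair
  rw [← Complex.ofReal_mul, ← Complex.ofReal_mul, Finset.mul_sum]
  congr 1
  refine Finset.sum_congr rfl fun i _ => ?_
  by_cases h : v.toTorusSite = u.toTorusSite + Pi.single i 1
  · rw [if_pos h, if_pos h, huv i h, sgn_zero_right]; ring
  · rw [if_neg h, if_neg h, mul_zero]

/-! ### Locality of the moments `tr N_R^m` -/

variable {d : FermionTorus 2 L → FermionTorus 2 L → ℕ}
  (hd : ∀ u v : FermionTorus 2 L, d u v =
      max (u.toTorusSite 0 - v.toTorusSite 0).valMinAbs.natAbs
        (u.toTorusSite 1 - v.toTorusSite 1).valMinAbs.natAbs)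

include hd in
/-- The Nambu matrix has range `≤ 1` in the sup-circular distance. -/
theorem visonNambu_range {μ Δ₀ : ℝ} {R : ℕ}
    {u v : FermionTorus 2 L} {σ σ' : Fin 2} (h : visonNambu L μ Δ₀ R (orb u σ) (orb v σ') ≠ 0) :
    d u v ≤ 1 := by
  by_contra hlt
  refine h (visonNambu_apply_eq_zero μ Δ₀ R ?_
    (fun i hi => hlt (torusSupDist_le_one_of_step hd hi).1)
    (fun i hi => hlt (torusSupDist_le_one_of_step hd hi).2) σ σ')
  rintro rfl
  rw [torusSupDist_self hd] at hlt
  exact hlt (Nat.zero_le 1)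

include hd in
/-- **Local Z₂ gauge**: for `x` far from both string ends (row `0` farther than `m`, or columns `0`
and `R` both farther than `m`) some `ε : sites → {±1}` has `ε_u ε_v = s_R(u,i)` on every bond
`(u, u + eᵢ)` leaving the ball `B(x,m)` (`4m + 2 ≤ L`): `ε ≡ 1`, or `−1` exactly on rows `1…⌊L/2⌋`. -/
theorem exists_local_gauge {R m : ℕ} (hR : 2 * R ≤ L) (hm : 4 * m + 2 ≤ L) {x : FermionTorus 2 L}
    (hfar : m < (x.toTorusSite 1).valMinAbs.natAbs ∨
      (m < (x.toTorusSite 0).valMinAbs.natAbs ∧ m < (x.toTorusSite 0 - R).valMinAbs.natAbs)) :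
    ∃ ε : FermionTorus 2 L → ℝ, (∀ w, ε w = 1 ∨ ε w = -1) ∧
      ∀ (u v : FermionTorus 2 L) (i : Fin 2), d x u ≤ m →
        v.toTorusSite = u.toTorusSite + Pi.single i 1 → ε u * ε v = sgn L R u.toTorusSite i := by
  classical
  refine ⟨fun w => if ((x.toTorusSite 1).valMinAbs.natAbs ≤ m ∧ (x.toTorusSite 0).val < R) ∧
      (1 ≤ (w.toTorusSite 1).val ∧ (w.toTorusSite 1).val ≤ L / 2) then -1 else 1,
    fun w => by dsimp only; split_ifs <;> simp, ?_⟩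
  intro u v i hu hstep
  rw [hd] at hu
  have hu0 := le_of_max_le_left hu
  have hu1 := le_of_max_le_right hu
  have hRL : R < L := by omega
  haveI : Fact (1 < L) := ⟨by omega⟩
  have hz : (u.toTorusSite 1 = 0) ↔ (u.toTorusSite 1).val = 0 := (ZMod.val_eq_zero _).symm
  obtain rfl | rfl : i = 0 ∨ i = 1 := by fin_cases i <;> simp
  · have h1 := congrFun hstep 1
    simp only [Pi.add_apply, Pi.single_apply, Fin.isValue, one_ne_zero, if_false, add_zero] at h1
    simp only [sgn, Fin.isValue, zero_ne_one, false_and, if_false, h1]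
    split_ifs <;> norm_num
  · have h1 := congrFun hstep 1
    simp only [Pi.add_apply, Pi.single_apply, Fin.isValue, if_true] at h1
    have hr := ZMod.val_lt (u.toTorusSite 1)
    have hr' : ((v.toTorusSite 1).val = (u.toTorusSite 1).val + 1 ∧
        (u.toTorusSite 1).val + 1 < L) ∨
        ((v.toTorusSite 1).val = 0 ∧ (u.toTorusSite 1).val + 1 = L) := by
      rw [h1, ZMod.val_add, ZMod.val_one]
      rcases Nat.lt_or_ge ((u.toTorusSite 1).val + 1) L with h | h
      · exact Or.inl ⟨Nat.mod_eq_of_lt h, h⟩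
      · exact Or.inr ⟨by rw [show (u.toTorusSite 1).val + 1 = L by omega, Nat.mod_self], by omega⟩
    have htri1 : (u.toTorusSite 1).val ≤ (x.toTorusSite 1).valMinAbs.natAbs + m ∨
        L ≤ (x.toTorusSite 1).valMinAbs.natAbs + m + (u.toTorusSite 1).val := by
      have h := zmod_natAbs_valMinAbs_add_le (x.toTorusSite 1) (-(x.toTorusSite 1 - u.toTorusSite 1))
      have e : x.toTorusSite 1 + -(x.toTorusSite 1 - u.toTorusSite 1) = u.toTorusSite 1 := by abel
      rw [e, ZMod.natAbs_valMinAbs_neg, ZMod.valMinAbs_natAbs_eq_min (u.toTorusSite 1)] at h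
      rcases min_le_iff.mp h with h' | h' <;> omega
    have htri2 : (x.toTorusSite 1).valMinAbs.natAbs ≤ m + (u.toTorusSite 1).val ∧
        (x.toTorusSite 1).valMinAbs.natAbs + (u.toTorusSite 1).val ≤ m + L := by
      have h := zmod_natAbs_valMinAbs_add_le (x.toTorusSite 1 - u.toTorusSite 1) (u.toTorusSite 1)
      rw [sub_add_cancel, ZMod.valMinAbs_natAbs_eq_min (u.toTorusSite 1)] at h
      constructor
      · have := h.trans (Nat.add_le_add hu1 (min_le_left _ _)); omega
      · have := h.trans (Nat.add_le_add hu1 (min_le_right _ _)); omega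
    simp only [sgn, Fin.isValue, true_and, hz]
    by_cases hG : (x.toTorusSite 1).valMinAbs.natAbs ≤ m ∧ (x.toTorusSite 0).val < R
    · have hcf : m < (x.toTorusSite 0).valMinAbs.natAbs ∧
          m < (x.toTorusSite 0 - R).valMinAbs.natAbs := hfar.resolve_left (by omega)
      have hcol : (u.toTorusSite 0).val < R :=
        (zmod_val_lt_iff_of_far_window hRL hcf.1 hcf.2 hu0).mpr hG.2
      have hG1 := hG.1
      simp only [hG, hcol, and_self, and_true, true_and]
      split_ifs <;> norm_num <;> omega
    · simp only [hG, false_and, if_false, one_mul]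
      rw [if_neg]
      rintro ⟨hr0, hcu⟩
      rcases hfar with hrow | hcf
      · omega
      · exact hG ⟨by omega, (zmod_val_lt_iff_of_far_window hRL hcf.1 hcf.2 hu0).mp hcu⟩

include hd in
/-- **Far sites see no vison**: for `x` far from the string ends and `4m + 2 ≤ L`, the diagonal
entries of `N_R^m` and `N_0^m` over `x` agree (local gauge + light cone). -/
theorem pow_apply_self_eq_of_far {μ Δ₀ : ℝ} {R m : ℕ} (hR : 2 * R ≤ L) (hm : 4 * m + 2 ≤ L)
    {x : FermionTorus 2 L}
    (hfar : m < (x.toTorusSite 1).valMinAbs.natAbs ∨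
      (m < (x.toTorusSite 0).valMinAbs.natAbs ∧ m < (x.toTorusSite 0 - R).valMinAbs.natAbs))
    (σ : Fin 2) :
    ((visonNambu L μ Δ₀ R) ^ m) (orb x σ) (orb x σ) =
      ((visonNambu L μ Δ₀ 0) ^ m) (orb x σ) (orb x σ) := by
  obtain ⟨ε, hε1, hε⟩ := exists_local_gauge hd hR hm hfar
  have hεsq : ∀ w, ε w * ε w = 1 := fun w => by rcases hε1 w with h | h <;> simp [h]
  set e : Orb (FermionTorus 2 L) → ℂ := fun o => (ε (ofLex o).1 : ℂ) with he
  have hee : ∀ o, e o * e o = 1 := fun o => by simp only [he]; exact_mod_cast hεsq _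
  rw [← diagonal_involution_conj_pow_apply_self e hee (visonNambu L μ Δ₀ 0) m (orb x σ)]
  refine matrix_pow_apply_eq_of_lightCone (fun o o' => d (ofLex o).1 (ofLex o').1)
    (fun a b c => torusSupDist_triangle hd _ _ _) (M := visonNambu L μ Δ₀ R)
    (N := Matrix.diagonal e * visonNambu L μ Δ₀ 0 * Matrix.diagonal e) ?_ (orb x σ) m ?_ m
    (orb x σ) (orb x σ) (by simp [torusSupDist_self hd])
  · exact fun a b hab => visonNambu_range hd (u := (ofLex a).1) (σ := (ofLex a).2)
      (v := (ofLex b).1) (σ' := (ofLex b).2) hab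
  · intro a b hxa
    obtain ⟨⟨ua, σa⟩, rfl⟩ : ∃ p : FermionTorus 2 L × Fin 2, toLex p = a := ⟨ofLex a, rfl⟩
    obtain ⟨⟨ub, σb⟩, rfl⟩ : ∃ p : FermionTorus 2 L × Fin 2, toLex p = b := ⟨ofLex b, rfl⟩
    change d x ua < m at hxa
    have hxa' : d x ua ≤ m := hxa.le
    have huv : ∀ i : Fin 2, ub.toTorusSite = ua.toTorusSite + Pi.single i 1 →
        ε ua * ε ub = sgn L R ua.toTorusSite i := fun i hi => hε ua ub i hxa' hi
    have hvu : ∀ i : Fin 2, ua.toTorusSite = ub.toTorusSite + Pi.single i 1 →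
        ε ub * ε ua = sgn L R ub.toTorusSite i := fun i hi => by
      have := torusSupDist_triangle hd x ua ub
      have := (torusSupDist_le_one_of_step hd hi).2
      exact hε ub ua i (by omega) hi
    have hvu' : ∀ i : Fin 2, ua.toTorusSite = ub.toTorusSite + Pi.single i 1 →
        ε ua * ε ub = sgn L R ub.toTorusSite i := fun i hi => by rw [mul_comm]; exact hvu i hi
    change visonNambu L μ Δ₀ R (orb ua σa) (orb ub σb) = _
    rw [Matrix.mul_diagonal, Matrix.diagonal_mul]
    change _ = (ε ua : ℂ) * visonNambu L μ Δ₀ 0 (orb ua σa) (orb ub σb) * (ε ub : ℂ)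
    unfold visonNambu
    rw [bdgNambuMatrix_gauge_orb_orb (visonHop L 0) (visonPair L Δ₀ 0) (visonHop L R)
      (visonPair L Δ₀ R) μ ε ua ub (fun h => by subst h; exact hεsq ua)
      (visonHop_gauge R huv hvu') (by rw [visonHop_swap R, visonHop_swap 0, visonHop_gauge R huv hvu'])
      (visonPair_gauge Δ₀ R huv) (by rw [mul_comm (ε ua : ℂ)]; exact visonPair_gauge Δ₀ R hvu)]
    ring

/-- **Moment locality**: `|tr N_R^m − tr N_0^m| ≤ 16(2m+1)² K^m`, `K = 8 + 8|Δ₀| + |μ|`, uniformly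
in `L`, `2R ≤ L` (only the `≤ 2(2m+1)²` sites near a string end contribute, each at most `4K^m`;
if the ball does not fit, `L ≤ 4m+1` and all `L²` sites are near). -/
theorem abs_trace_pow_sub_le {μ Δ₀ : ℝ} {R : ℕ} (hR : 2 * R ≤ L) (m : ℕ) :
    |((visonNambu L μ Δ₀ R) ^ m).trace.re - ((visonNambu L μ Δ₀ 0) ^ m).trace.re| ≤
      16 * (2 * m + 1) ^ 2 * (8 + 8 * |Δ₀| + |μ|) ^ m := by
  set K := 8 + 8 * |Δ₀| + |μ| with hK
  have hKm : 0 ≤ K ^ m := pow_nonneg (by positivity) m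
  have hent : ∀ (R' : ℕ) (o : Orb (FermionTorus 2 L)), ‖((visonNambu L μ Δ₀ R') ^ m) o o‖ ≤
      K ^ m := fun R' o => matrix_norm_pow_apply_le (visonNambu_row_le μ Δ₀ R') m o o
  set f : FermionTorus 2 L → ℝ := fun x => ∑ σ : Fin 2,
    (((visonNambu L μ Δ₀ R) ^ m) (orb x σ) (orb x σ) -
      ((visonNambu L μ Δ₀ 0) ^ m) (orb x σ) (orb x σ)).re with hf
  have hdiff : ((visonNambu L μ Δ₀ R) ^ m).trace.re - ((visonNambu L μ Δ₀ 0) ^ m).trace.re =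
      ∑ x, f x := by
    simp only [Matrix.trace, Matrix.diag_apply, Complex.re_sum, ← Finset.sum_sub_distrib,
      ← Complex.sub_re, hf]
    exact sum_orb_eq_sum_sum _
  have hterm : ∀ x, |f x| ≤ 2 * (2 * K ^ m) := fun x => by
    refine (Finset.abs_sum_le_sum_abs _ _).trans ?_
    refine (Finset.sum_le_sum fun σ _ => (Complex.abs_re_le_norm _).trans
      ((norm_sub_le _ _).trans (add_le_add (hent R (orb x σ)) (hent 0 (orb x σ))))).trans ?_
    simp [two_mul]
  have hS : ∀ S : Finset (FermionTorus 2 L), |∑ x ∈ S, f x| ≤ S.card * (2 * (2 * K ^ m)) :=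
    fun S => (Finset.abs_sum_le_sum_abs _ _).trans ((Finset.sum_le_sum fun x _ => hterm x).trans
      (by rw [Finset.sum_const, nsmul_eq_mul]))
  rw [hdiff]
  rcases Nat.lt_or_ge L (4 * m + 2) with hsmall | hbig
  · refine (hS _).trans ?_
    rw [Finset.card_univ, Fintype.card_lex, Fintype.card_fun, Fintype.card_fin, Fintype.card_fin]
    have hL' : (L : ℝ) ≤ 4 * m + 1 := by exact_mod_cast (by omega : L ≤ 4 * m + 1)
    push_cast
    nlinarith [mul_le_mul hL' hL' L.cast_nonneg (by positivity)]
  · set near := Finset.univ.filter fun x : FermionTorus 2 L =>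
        (x.toTorusSite 1).valMinAbs.natAbs ≤ m ∧
          ((x.toTorusSite 0).valMinAbs.natAbs ≤ m ∨
            (x.toTorusSite 0 - R).valMinAbs.natAbs ≤ m) with hnear
    have hzero : ∀ x ∈ Finset.univ, x ∉ near → f x = 0 := by
      intro x _ hx
      simp only [hnear, Finset.mem_filter, Finset.mem_univ, true_and, not_and_or, not_or,
        not_le] at hx
      refine Finset.sum_eq_zero fun σ _ => ?_
      rw [pow_apply_self_eq_of_far (d := fun u v : FermionTorus 2 L =>
          max (u.toTorusSite 0 - v.toTorusSite 0).valMinAbs.natAbs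
            (u.toTorusSite 1 - v.toTorusSite 1).valMinAbs.natAbs) (fun _ _ => rfl) hR hbig hx σ,
        sub_self, Complex.zero_re]
    rw [← Finset.sum_subset (Finset.subset_univ near) hzero]
    refine (hS _).trans ?_
    have hc : (near.card : ℝ) ≤ (2 * m + 1) * (2 * (2 * m + 1)) := by
      exact_mod_cast fermionTorus_card_nearStringEnd_le (L := L) R m
    nlinarith

end Vison

/-! ### The ultraviolet bound -/

/-- **Ultraviolet bound** (registered stub `stub_ultraviolet` of line `Sketch`): with
`K = 8 + 8|Δ₀| + |μ|`, `t₀ = 2K`, `C = 400K²`, for all `L ≥ 4`, `2R ≤ L`, `t ≥ t₀`: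
`|log‖det(N_R+it)‖ − log‖det(N_0+it)‖| ≤ C/t²`.  Proof: `2D_t = Σ_k (−1)^k (tr N_R^{2k+2} −
tr N_0^{2k+2})/((k+1)t^{2k+2})` (log-determinant series, `|λᵢ| ≤ K < t`) and moment locality. -/
theorem stub_ultraviolet : Ultraviolet := by
  intro μ Δ₀
  set K : ℝ := 8 + 8 * |Δ₀| + |μ| with hK
  have hK8 : 8 ≤ K := by have := abs_nonneg Δ₀; have := abs_nonneg μ; linarith
  have hKpos : 0 < K := by linarith
  refine ⟨2 * K, 400 * K ^ 2, by linarith, ?_⟩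
  intro L _ hL R hR t ht
  have ht0 : 0 < t := by linarith
  have hA : ∀ R', (visonNambu L μ Δ₀ R').IsHermitian := isHermitian_visonNambu μ Δ₀
  have hlt : ∀ R' i, (hA R').eigenvalues i ^ 2 < t ^ 2 := fun R' i =>
    (hermitian_eigenvalues_sq_le_of_norm_pow_apply_le (hA R') hKpos
      (fun m a => matrix_norm_pow_apply_le (visonNambu_row_le μ Δ₀ R') m a a) i).trans_lt
      (by nlinarith)
  have hS := fun R' => hermitian_hasSum_logDet_series (hA R') ht0 (hlt R')
  have hD := (hS R).sub (hS 0)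
  set q : ℝ := K ^ 2 / t ^ 2 with hq
  have hq0 : 0 ≤ q := by positivity
  have hq4 : q ≤ 1 / 4 := by rw [hq, div_le_iff₀ (by positivity)]; nlinarith
  have hbound : ∀ k : ℕ,
      ‖(-1 : ℝ) ^ k * ((visonNambu L μ Δ₀ R) ^ (2 * (k + 1))).trace.re /
            ((k + 1) * t ^ (2 * (k + 1))) -
          (-1 : ℝ) ^ k * ((visonNambu L μ Δ₀ 0) ^ (2 * (k + 1))).trace.re /
            ((k + 1) * t ^ (2 * (k + 1)))‖ ≤ 400 * q * (1 / 2) ^ k := by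
    intro k
    have hTr := abs_trace_pow_sub_le (L := L) (μ := μ) (Δ₀ := Δ₀) hR (2 * (k + 1))
    set a := ((visonNambu L μ Δ₀ R) ^ (2 * (k + 1))).trace.re
    set b := ((visonNambu L μ Δ₀ 0) ^ (2 * (k + 1))).trace.re
    have hk1 : (0 : ℝ) < k + 1 := by positivity
    have hDpos : (0 : ℝ) < (k + 1) * t ^ (2 * (k + 1)) := by positivity
    rw [Real.norm_eq_abs, show (-1 : ℝ) ^ k * a / ((k + 1) * t ^ (2 * (k + 1))) -
        (-1 : ℝ) ^ k * b / ((k + 1) * t ^ (2 * (k + 1))) =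
        (-1) ^ k * (a - b) / ((k + 1) * t ^ (2 * (k + 1))) by ring, abs_div, abs_mul, abs_pow,
      abs_neg, abs_one, one_pow, one_mul, abs_of_pos hDpos]
    calc |a - b| / ((k + 1) * t ^ (2 * (k + 1)))
        ≤ 16 * (2 * (2 * (k + 1)) + 1) ^ 2 * K ^ (2 * (k + 1)) / ((k + 1) * t ^ (2 * (k + 1))) :=
          div_le_div_of_nonneg_right (by exact_mod_cast hTr) hDpos.le
      _ = 16 * (4 * k + 5) ^ 2 / (k + 1) * q ^ (k + 1) := by
          rw [hq, div_pow, ← pow_mul, ← pow_mul]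
          field_simp
          ring
      _ ≤ 400 * (k + 1) * q ^ (k + 1) := by
          refine mul_le_mul_of_nonneg_right ?_ (pow_nonneg hq0 _)
          rw [div_le_iff₀ hk1]
          nlinarith
      _ = 400 * q * ((k + 1) * q ^ k) := by ring
      _ ≤ 400 * q * (1 / 2) ^ k := by
          refine mul_le_mul_of_nonneg_left ?_ (by positivity)
          calc (k + 1) * q ^ k ≤ 2 ^ k * (1 / 4) ^ k := mul_le_mul (by exact_mod_cast
                  Nat.lt_two_pow_self) (pow_le_pow_left₀ hq0 hq4 k) (pow_nonneg hq0 k) (by positivity)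
            _ = (1 / 2) ^ k := by rw [← mul_pow]; norm_num
  have hg : HasSum (fun k : ℕ => 400 * q * (1 / 2) ^ k) (400 * q * 2) :=
    hasSum_geometric_two.mul_left (400 * q)
  have h2D : |2 * logDetKernel (visonNambu L μ Δ₀ R) (visonNambu L μ Δ₀ 0) t| ≤ 400 * q * 2 := by
    refine le_of_eq_of_le ?_ (hD.norm_le_of_bounded hg hbound)
    rw [Real.norm_eq_abs]
    congr 1
    unfold logDetKernel
    ring
  rw [abs_mul, abs_two] at h2D
  calc |logDetKernel (visonNambu L μ Δ₀ R) (visonNambu L μ Δ₀ 0) t| ≤ 400 * q := by linarith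
    _ = 400 * K ^ 2 / t ^ 2 := by rw [hq]; ring

end Summit.HubbardSuperconductivity.HubbardSuperconductivity.Theorems.VisonPairCost

end
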